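import Literature.MathematicalPhysics.QuantumManyBody.MarginalSturmPackage
import HarnessLib

/-!
# Route `BECTangentRigidity`, crux `RigidMomentumBound` (stmt-AtomisticToContinuum-13034):
# stub `stub_sturmPackage` — the one-dimensional Sturm / Picone package for the marginal

Pure one-dimensional real analysis, no Bose-gas objects. Coordinates: a Dirichlet wall at `s = 0`,
the box extends to `S ≥ 2s₀`, `s₀ = π/(2√μ)` the quarter period. Data: the marginal mass `m ≥ 0`
(continuous on `[0, S]`, `m(0) = 0`, `m = ∫₀ p`), the normal slice kinetic energy `et ≥ 0` and the
full slice energy `e ≥ et` (integrable), the Cauchy–Schwarz relation `p² ≤ 4 m·et` a.e., the local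
virial identity `∫g e + ½∫g' p = E' ∫g m` for every `C¹` test function `g`, the slice bound
`∫g et + E₁ ∫g m ≤ ∫g e` for `g ≥ 0`, `E' - E₁ ≤ μ`, and slab mass `∫₀^{2s₀} m ≤ η`. Conclusion:
`∫₀^σ et ≤ 8 μ^{3/2} η σ` for every `0 < σ ≤ s₀/2`.

The whole proof lives in the Literature files `MarginalSturmTestMonotone`, `MarginalSturmWronskian`,
`MarginalSturmComparison`, `MarginalSturmPackage` under
`Literature/MathematicalPhysics/QuantumManyBody/` (namespace
`Literature.MathematicalPhysics.QuantumManyBody.BoseGas.MarginalSturm`):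

1. du Bois-Reymond (`MarginalSturm.exists_continuous_slope`, from the tree lemma
   `Literature.Analysis.FunctionSpaces.ae_eq_add_setIntegral_of_forall_test`): testing the virial
   identity with all `C¹` `g` shows `p = p̄ := 2∫₀(e - E'm)` a.e., so `m` is `C¹` with `m' = p̄`;
   the two `g`-hypotheses combine to the weak subsolution inequality
   `∫g et + ½∫g' p̄ ≤ μ ∫g m` for `C¹` `g ≥ 0` (i.e. `q'' + μq ≥ 0` weakly for `q = √m`, using
   `q'² = p̄²/(4m) ≤ et`).
2. Picone's substitution `G = g sin(√μ·)/√m` in that inequality gives `∫ g' W ≤ 0` on intervals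
   where `m > 0`, `W = q' sin(√μ·) - q (sin(√μ·))'` the Wronskian
   (`integral_deriv_mul_wronskian_nonpos`), hence `W` is nondecreasing there
   (`le_of_forall_integral_deriv_mul_nonpos`, `C¹` plateau bumps).
3. Wall comparison (`wall_wronskian_nonneg`): `W ≥ 0` on `(0, π/√μ)` (at the last zero of `m`
   before a point with `W < 0`, `√m` would have to decrease from `0`), so `m/sin²(√μ·)` is
   nondecreasing (`monotoneOn_div_sin_sq`) and `m(s) ≤ Φ s²`, `Φ = (4/π) μ^{3/2} η`, on `(0, s₀]`
   (`le_integral_mul_sq_of_monotoneOn`); also `p̄ ≥ 0` on `(0, s₀]`.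
4. Testing with the `C¹` wall profile equal to `1` on `[0, σ]` and `0` on `[2σ, ∞)`
   (`BoseGasWallCutoff`, slope `≤ π/(2σ)`): `∫₀^σ et ≤ μ∫₀^{2σ} m + (π/(4σ)) m(2σ) ≤ Φσ(π²/6 + π)
   = (4 + 2π/3) μ^{3/2} η σ ≤ 8 μ^{3/2} η σ` (`integral_le_of_weak_subsolution`,
   `integral_normalKinetic_le`).

On the exact profile `m = (2/π)sin²`, `et = e = (2/π)cos²`, `μ = E' = 1`, `E₁ = 0` every hypothesis
is an equality.
-/

noncomputable section

namespace Summit.AtomisticToContinuum.BoseEinsteinCondensation.Theorems.RigidMomentumBound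

open MeasureTheory Filter Set intervalIntegral
open scoped Topology

/-- **`stub_sturmPackage`** (pure one-dimensional real analysis). The Sturm / Picone comparison
package for the one-coordinate marginal of a ground state, in weak form: wall at `s = 0`, box up to
`S`; marginal mass `m ≥ 0` (continuous, `m(0) = 0`, `m = ∫₀ p`), normal slice kinetic energy
`et ≥ 0` and full slice energy `e ≥ et` (integrable) with `p² ≤ 4 m·et` a.e., the local virial
identity `∫g e + ½∫g'p = E'∫g m` for every `C¹` test function `g`, the slice bound
`∫g e ≥ ∫g et + E₁∫g m` for `g ≥ 0`, `E' - E₁ ≤ μ`, slab mass `∫₀^{2s₀} m ≤ η` at the quarter period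
`s₀ = π/(2√μ)` (`2s₀ ≤ S`). Conclusion: `∫₀^σ et ≤ 8 μ^{3/2} η σ` for every `0 < σ ≤ s₀/2`.
This is `MarginalSturm.integral_normalKinetic_le` of
`Literature/MathematicalPhysics/QuantumManyBody/MarginalSturmPackage.lean` (du Bois-Reymond
regularity, Picone's weak Wronskian monotonicity, Sturm comparison with `sin(√μ·)` from the wall,
test against a `C¹` smoothed indicator of `[0, σ]`). [Sturm 1836; Picone 1910;
folklore] -/
theorem stub_sturmPackage :
    ∀ (S μ η E' E₁ : ℝ) (m p et e : ℝ → ℝ), 0 < μ → 0 ≤ η → E' - E₁ ≤ μ →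
      2 * (Real.pi / (2 * Real.sqrt μ)) ≤ S →
      ContinuousOn m (Set.Icc 0 S) → m 0 = 0 → (∀ s ∈ Set.Icc 0 S, 0 ≤ m s) →
      IntegrableOn p (Set.Icc 0 S) → IntegrableOn et (Set.Icc 0 S) → IntegrableOn e (Set.Icc 0 S) →
      (∀ s ∈ Set.Icc 0 S, m s = ∫ x in (0 : ℝ)..s, p x) →
      (∀ᵐ s ∂(volume.restrict (Set.Icc 0 S)), 0 ≤ et s ∧ et s ≤ e s ∧ p s ^ 2 ≤ 4 * m s * et s) →
      (∀ g : ℝ → ℝ, ContDiff ℝ 1 g →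
        (∫ s in (0 : ℝ)..S, g s * e s) + (1 / 2) * (∫ s in (0 : ℝ)..S, deriv g s * p s) =
          E' * ∫ s in (0 : ℝ)..S, g s * m s) →
      (∀ g : ℝ → ℝ, ContDiff ℝ 1 g → (∀ s, 0 ≤ g s) →
        (∫ s in (0 : ℝ)..S, g s * et s) + E₁ * (∫ s in (0 : ℝ)..S, g s * m s) ≤
          ∫ s in (0 : ℝ)..S, g s * e s) →
      (∫ s in (0 : ℝ)..(2 * (Real.pi / (2 * Real.sqrt μ))), m s) ≤ η →
      ∀ σ : ℝ, 0 < σ → σ ≤ Real.pi / (2 * Real.sqrt μ) / 2 →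
        (∫ s in (0 : ℝ)..σ, et s) ≤ 8 * μ * Real.sqrt μ * η * σ := by
  intro S μ η E' E₁ m p et e hμ hη hE hS hmc hm0 hmnn hpi heti hei hmp hae hvir hslice hmass σ hσ hσ'
  exact Literature.MathematicalPhysics.QuantumManyBody.BoseGas.MarginalSturm.integral_normalKinetic_le
    S μ η E' E₁ m p et e hμ hη hE hS hmc hm0 hmnn hpi heti hei hmp hae hvir hslice hmass hσ hσ'

end Summit.AtomisticToContinuum.BoseEinsteinCondensation.Theorems.RigidMomentumBound
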